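import Literature.Analysis.FluidPDE.PassiveVectorTensorGalerkinSmoothLimit
import Literature.Analysis.FluidPDE.PassiveVectorGalerkinWeakForm
import Literature.Analysis.FluidPDE.PassiveVectorTensorLipschitzTest
import HarnessLib

/-!
# The Fourier–Galerkin scheme with a smooth carrier, IV: the Galerkin equations in weak form

Analysis/FluidPDE proof-support file (theorems only; no named facts), sequel of `PassiveVectorTensorGalerkinSmoothLimit`,
ported from `PassiveVectorGalerkinWeakForm` (Robinson–Rodrigo–Sadowski 2016, Thm. 4.4 Step 4: the truncated system tested
against a space–time test field and integrated by parts in time). Differences: the viscous term is the constant tensor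
`𝔸` — the Galerkin field carries the ADJOINT symbol `T_𝔸(k)`, so the tested viscous term is `∫⟪u_N, 𝓛^*_{𝔸ᵀ} Ψ⟫`
(`viscAdj (majorTranspose 𝔸)`, by the adjoint identity `∫⟪𝓛_𝔹 u, a⟫ = ∫⟪u, 𝓛_𝔹^* a⟫` and `𝓛_{𝔸ᵀ} = 𝓛_𝔸^*`); and
the carrier is the smooth field itself (no truncation of `b`, the exact transport coefficient).

* `PVSSetup.sum_inner_rhs_eq` — `Σ_k ⟪V(b t, α_N t)_k, â(k)⟫_ℝ = ∫⟪u_N, 𝓛^*_{𝔸ᵀ} a⟫ + ∫⟪u_N, (b·∇)(P_N a)⟫`;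
* `PVSSetup.galerkin_weak_identity` — `∫_{(0,T)}∫⟪u_N, ∂ₜΨ + (b·∇)(P_N Ψ) + 𝓛^*_{𝔸ᵀ} Ψ⟫ + ∫⟪P_N w₀, Ψ 0⟫ = 0`.

## References

* J. C. Robinson, J. L. Rodrigo, W. Sadowski, *The three-dimensional Navier–Stokes equations* (CUP 2016), §4.2,
  Thm. 4.4 Step 4, (4.5), Lemma 3.2. [`RobinsonRodrigoSadowski2016`]
* P. Constantin, C. Foias, *Navier–Stokes Equations* (Chicago UP 1988), Ch. 8, (8.3)–(8.9). [`ConstantinFoias1988`]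
* U. Frisch, *Turbulence* (CUP 1995), §9.6.3 eq. (9.57). [`Frisch1995Turbulence`]
-/

open MeasureTheory Set Filter Topology UnitAddTorus Metric Function
open scoped ENNReal NNReal InnerProductSpace

noncomputable section

namespace Literature.Analysis.FluidPDE

namespace Torus

open FunctionSpaces.Torus FunctionSpaces

variable {d : Type*} [Fintype d] [DecidableEq d]

section GalerkinWeak

variable {𝔸 : Visc4 d} {lo hi : ℝ} {b : ℝ → UnitAddTorus d → EuclideanSpace ℝ d} {M G : ℝ}
  {w₀ : UnitAddTorus d → EuclideanSpace ℝ d}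

/-- The initial Galerkin approximation is the truncated datum `P_N w₀`. [cite: RobinsonRodrigoSadowski2016, Thm. 4.4 Step 1 (4.3)] -/
theorem PVSSetup.galerkinApprox_zero (h : PVSSetup 𝔸 lo hi b M G w₀) (N : ℕ) :
    h.galerkinApprox N 0 = fourierTruncate N w₀ := by
  rw [PVSSetup.galerkinApprox, fourierTruncate_eq]
  have h0 : h.galerkinCoeffAt N 0 = coeffExt (freqBall N) (datumTrunc w₀ N) := by
    funext k; rw [PVSSetup.galerkinCoeffAt, (h.galerkinCoeff_spec N).1]
  rw [h0]
  exact realTrigPoly_coeffExt_restrict _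

/-- The pairing of the Galerkin approximation with an `L²` field, on the Fourier side:
`∫⟪u_N(t), g⟫ = ∑_{k ∈ freqBall N} ⟪α_N(t)(k), ĝ(k)⟫_ℝ`. [cite: Grafakos2014, Prop. 3.2.7 (3)] -/
theorem PVSSetup.integral_inner_galerkinApprox (h : PVSSetup 𝔸 lo hi b M G w₀) (N : ℕ) (t : ℝ)
    {g : UnitAddTorus d → EuclideanSpace ℝ d} (hg : MemLp g 2 volume) :
    ∫ x, ⟪h.galerkinApprox N t x, g x⟫_ℝ =
      ∑ k : ↥(freqBall (d := d) N), ⟪h.galerkinCoeff N t k, mFourierCoeff (EuclideanSpace.complexify ∘ g) k⟫_ℝ := by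
  rw [PVSSetup.galerkinApprox, integral_inner_realTrigPoly_left neg_mem_freqBall_of_mem (h.isConjSymm_galerkinCoeffAt N t) hg,
    ← Finset.sum_coe_sort]
  refine Finset.sum_congr rfl fun k _ => ?_
  rw [real_inner_eq_re_inner_euclidean, PVSSetup.galerkinCoeffAt, coeffExt_coe]

/-- The Galerkin approximation is its own truncation: `P_N u_N = u_N`. [cite: RobinsonRodrigoSadowski2016, Lemma 2.9] -/
theorem PVSSetup.fourierTruncate_galerkinApprox (h : PVSSetup 𝔸 lo hi b M G w₀) (N : ℕ) (t : ℝ) :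
    fourierTruncate N (h.galerkinApprox N t) = h.galerkinApprox N t := by
  rw [fourierTruncate_eq, PVSSetup.galerkinApprox]
  refine realTrigPoly_congr fun k hk => ?_
  rw [← PVSSetup.galerkinApprox, h.mFourierCoeff_galerkinApprox N t k]

omit [Fintype d] [DecidableEq d] in
/-- `Re(c · conj z) = Re(c · z)` for a real `c`. [folklore] -/
private theorem re_mul_conj_eq₀ (c z : ℂ) (hc : c.im = 0) : (c * (starRingEnd ℂ) z).re = (c * z).re := by
  simp [Complex.mul_re, hc]

/-- **The tested tensor term**: for a smooth `a`,
`∫⟪u_N(t), 𝓛^*_{𝔸ᵀ} a⟫ = Σ_{k ∈ freqBall N} Re(−4π² ⟪T_𝔸(k) α_N(t)(k), â(k)⟫)` (adjoint identity, `𝓛_{𝔸ᵀ} = 𝓛_𝔸^*`,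
`P_N u_N = u_N`, single-mode symbol). [cite: Frisch1995Turbulence, §9.6.3 eq. (9.57) p. 233] -/
theorem PVSSetup.integral_inner_galerkinApprox_viscAdj (h : PVSSetup 𝔸 lo hi b M G w₀) (N : ℕ) (t : ℝ)
    {a : UnitAddTorus d → EuclideanSpace ℝ d} (ha : IsSmooth a) :
    ∫ x, ⟪h.galerkinApprox N t x, viscAdj (majorTranspose 𝔸) a x⟫_ℝ =
      ∑ k ∈ freqBall (d := d) N, ((-(4 * Real.pi ^ 2 : ℝ) : ℂ) *
        ⟪symbT 𝔸 k (h.galerkinCoeffAt N t k), mFourierCoeff (EuclideanSpace.complexify ∘ a) k⟫_ℂ).re := by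
  have hu : IsSmooth (h.galerkinApprox N t) := isSmooth_realTrigPoly _ _
  -- move `𝓛^*_{𝔸ᵀ}` onto `u_N` as `𝓛_{𝔸ᵀ} = 𝓛_𝔸^*`
  have e1 : ∫ x, ⟪h.galerkinApprox N t x, viscAdj (majorTranspose 𝔸) a x⟫_ℝ =
      ∫ x, ⟪a x, viscAdj 𝔸 (fourierTruncate N (h.galerkinApprox N t)) x⟫_ℝ := by
    rw [← integral_inner_viscOp_eq_integral_inner_viscAdj (majorTranspose 𝔸) hu ha, h.fourierTruncate_galerkinApprox N t]
    refine integral_congr_ae (ae_of_all _ fun x => ?_)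
    show ⟪viscOp (majorTranspose 𝔸) (h.galerkinApprox N t) x, a x⟫_ℝ = ⟪a x, viscAdj 𝔸 (h.galerkinApprox N t) x⟫_ℝ
    rw [viscOp_eq_viscAdj_majorTranspose _ hu, majorTranspose_majorTranspose, real_inner_comm]
  rw [e1, integral_inner_viscAdj_fourierTruncate_eq_sum ((ha.memLp 2).integrable one_le_two) 𝔸 _ N]
  refine Finset.sum_congr rfl fun k _ => ?_
  rw [h.mFourierCoeff_galerkinApprox N t k]
  conv_lhs => rw [← inner_conj_symm]
  exact re_mul_conj_eq₀ _ _ (by simp [pow_succ, Complex.mul_im])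

/-- **The tested right-hand side of the Galerkin system, on the Fourier side.** For a smooth divergence-free `a`:
`∑_{k} ⟪V(b t, α_N t)_k, â(k)⟫_ℝ = ∫⟪u_N(t), 𝓛^*_{𝔸ᵀ} a⟫ + ∫⟪u_N(t), (b(t)·∇)(P_N a)⟫`
(tensor term by the previous lemma; transport term by `Π_k â_k = â_k`, Parseval against the band-limited `P_N a` and
antisymmetry). [cite: RobinsonRodrigoSadowski2016, Thm. 4.4 Step 1 (4.5)] -/
theorem PVSSetup.sum_inner_rhs_eq (h : PVSSetup 𝔸 lo hi b M G w₀) (N : ℕ) (t : ℝ)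
    {a : UnitAddTorus d → EuclideanSpace ℝ d} (ha : IsSmooth a) (hadiv : IsDivFree a) :
    ∑ k : ↥(freqBall (d := d) N), ⟪pvsRHS (freqBall N) 𝔸 (b t) (h.galerkinCoeff N t) k,
        mFourierCoeff (EuclideanSpace.complexify ∘ a) k⟫_ℝ =
      (∫ x, ⟪h.galerkinApprox N t x, viscAdj (majorTranspose 𝔸) a x⟫_ℝ) +
        ∫ x, ⟪h.galerkinApprox N t x, FunctionSpaces.Torus.convect (b t) (fourierTruncate N a) x⟫_ℝ := by
  have hS : ∀ k ∈ freqBall (d := d) N, -k ∈ freqBall N := neg_mem_freqBall_of_mem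
  have hbs : IsSmooth (b t) := h.carrier.smooth t
  have hbdiv : IsDivFree (b t) := h.carrier.divFree t
  have hâ : ∀ k, ∑ i, (k i : ℂ) * mFourierCoeff (EuclideanSpace.complexify ∘ a) k i = 0 :=
    fun k => hadiv.sum_mul_mFourierCoeff_eq_zero ha k
  have hu : IsSmooth (h.galerkinApprox N t) := isSmooth_realTrigPoly _ _
  -- split the field termwise
  have hsplit : ∀ k : ↥(freqBall (d := d) N),
      ⟪pvsRHS (freqBall N) 𝔸 (b t) (h.galerkinCoeff N t) k, mFourierCoeff (EuclideanSpace.complexify ∘ a) k⟫_ℝ =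
      ((-(4 * Real.pi ^ 2 : ℝ) : ℂ) *
          ⟪symbT 𝔸 k (h.galerkinCoeffAt N t k), mFourierCoeff (EuclideanSpace.complexify ∘ a) k⟫_ℂ).re -
        (inner ℂ (pvsConvCoeff (freqBall N) (b t) (h.galerkinCoeffAt N t) k)
          (mFourierCoeff (EuclideanSpace.complexify ∘ a) k)).re := by
    intro k
    have e : pvsRHS (freqBall N) 𝔸 (b t) (h.galerkinCoeff N t) k =
        pvsField 𝔸 (freqBall N) (b t) (h.galerkinCoeffAt N t) k := rfl
    rw [real_inner_eq_re_inner_euclidean, e, pvsField_def, inner_sub_left, Complex.sub_re, inner_neg_left,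
      inner_smul_left, Complex.conj_ofReal, inner_leraySym_left_of_transversal _ _ (hâ k),
      inner_leraySym_left_of_transversal _ _ (hâ k), Complex.neg_re]
    simp only [neg_mul, Complex.neg_re]
  -- the transport term
  have hTrans : ∑ k : ↥(freqBall (d := d) N),
      (inner ℂ (pvsConvCoeff (freqBall N) (b t) (h.galerkinCoeffAt N t) k)
        (mFourierCoeff (EuclideanSpace.complexify ∘ a) k)).re =
      -∫ x, ⟪h.galerkinApprox N t x, FunctionSpaces.Torus.convect (b t) (fourierTruncate N a) x⟫_ℝ := by
    have hF : MemLp (FunctionSpaces.Torus.convect (b t) (h.galerkinApprox N t)) 2 volume := (hbs.convect hu).memLp 2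
    have hasymm : IsConjSymm (fun k => mFourierCoeff (EuclideanSpace.complexify ∘ a) k) :=
      isConjSymm_mFourierCoeff ((ha.memLp 2).integrable one_le_two)
    have hP := integral_inner_realTrigPoly_right hS hasymm hF
    rw [← Finset.sum_coe_sort (freqBall (d := d) N), ← fourierTruncate_eq] at hP
    have e : ∀ k : d → ℤ, pvsConvCoeff (freqBall N) (b t) (h.galerkinCoeffAt N t) k =
        mFourierCoeff (EuclideanSpace.complexify ∘ FunctionSpaces.Torus.convect (b t) (h.galerkinApprox N t)) k :=
      fun k => rfl
    simp_rw [e]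
    rw [← hP, integral_inner_convect_eq_neg hbs hbdiv hu (isSmooth_fourierTruncate N a)]
  calc ∑ k : ↥(freqBall (d := d) N), ⟪pvsRHS (freqBall N) 𝔸 (b t) (h.galerkinCoeff N t) k,
        mFourierCoeff (EuclideanSpace.complexify ∘ a) k⟫_ℝ
      = ∑ k : ↥(freqBall (d := d) N), (((-(4 * Real.pi ^ 2 : ℝ) : ℂ) *
          ⟪symbT 𝔸 k (h.galerkinCoeffAt N t k), mFourierCoeff (EuclideanSpace.complexify ∘ a) k⟫_ℂ).re -
        (inner ℂ (pvsConvCoeff (freqBall N) (b t) (h.galerkinCoeffAt N t) k)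
          (mFourierCoeff (EuclideanSpace.complexify ∘ a) k)).re) := Finset.sum_congr rfl fun k _ => hsplit k
    _ = ∑ k : ↥(freqBall (d := d) N), ((-(4 * Real.pi ^ 2 : ℝ) : ℂ) *
          ⟪symbT 𝔸 k (h.galerkinCoeffAt N t k), mFourierCoeff (EuclideanSpace.complexify ∘ a) k⟫_ℂ).re -
        ∑ k : ↥(freqBall (d := d) N),
          (inner ℂ (pvsConvCoeff (freqBall N) (b t) (h.galerkinCoeffAt N t) k)
            (mFourierCoeff (EuclideanSpace.complexify ∘ a) k)).re := Finset.sum_sub_distrib _ _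
    _ = _ := by
        rw [h.integral_inner_galerkinApprox_viscAdj N t ha, hTrans, ← Finset.sum_coe_sort (freqBall (d := d) N)]
        ring

/-- **The Galerkin equations in weak form** (Robinson–Rodrigo–Sadowski 2016, Thm. 4.4 Step 4). For `T > 0` and a
divergence-free space–time test field `Ψ` on `[0, T)`, the Galerkin approximation `u_N` satisfies
`∫_{(0,T)} ∫ ⟪u_N, ∂ₜΨ + (b·∇)(P_N Ψ) + 𝓛^*_{𝔸ᵀ} Ψ⟫ + ∫ ⟪P_N w₀, Ψ(0)⟫ = 0`.
[cite: RobinsonRodrigoSadowski2016, Thm. 4.4 Step 4 (4.5)] -/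
theorem PVSSetup.galerkin_weak_identity (h : PVSSetup 𝔸 lo hi b M G w₀) (N : ℕ)
    {T : ℝ} (hT : 0 < T) {Ψ : ℝ → UnitAddTorus d → EuclideanSpace ℝ d} (hΨ : IsSpaceTimeTest T Ψ)
    (hΨdiv : ∀ t, IsDivFree (Ψ t)) :
    (∫ t in Ioo 0 T, ∫ x, ⟪h.galerkinApprox N t x, FunctionSpaces.Torus.timeDeriv Ψ t x +
        FunctionSpaces.Torus.convect (b t) (fourierTruncate N (Ψ t)) x + viscAdj (majorTranspose 𝔸) (Ψ t) x⟫_ℝ) +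
      ∫ x, ⟪fourierTruncate N w₀ x, Ψ 0 x⟫_ℝ = 0 := by
  obtain ⟨hα0, hmem, hcont, hsol, -⟩ := h.galerkinCoeff_spec N
  have hb := h.carrier
  -- Fourier-side pairing `f`, its derivative `g`, and the spatial form `G` of `g`
  set Ψh : ℝ → (d → ℤ) → EuclideanSpace ℂ d := fun t k => mFourierCoeff (EuclideanSpace.complexify ∘ Ψ t) k with hΨh
  set Ψh' : ℝ → (d → ℤ) → EuclideanSpace ℂ d :=
    fun t k => mFourierCoeff (EuclideanSpace.complexify ∘ FunctionSpaces.Torus.timeDeriv Ψ t) k with hΨh'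
  set V : ℝ → ↥(freqBall (d := d) N) → EuclideanSpace ℂ d :=
    fun t => pvsRHS (freqBall N) 𝔸 (b t) (h.galerkinCoeff N t) with hV
  set f : ℝ → ℝ := fun t => ∑ k : ↥(freqBall (d := d) N), ⟪h.galerkinCoeff N t k, Ψh t k⟫_ℝ with hf
  set g : ℝ → ℝ := fun t => ∑ k : ↥(freqBall (d := d) N),
    (⟪h.galerkinCoeff N t k, Ψh' t k⟫_ℝ + ⟪V t k, Ψh t k⟫_ℝ) with hg
  set Gt : ℝ → ℝ := fun t => ∫ x, ⟪h.galerkinApprox N t x, FunctionSpaces.Torus.timeDeriv Ψ t x +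
    FunctionSpaces.Torus.convect (b t) (fourierTruncate N (Ψ t)) x + viscAdj (majorTranspose 𝔸) (Ψ t) x⟫_ℝ with hGt
  -- (1) `f' = g` within `[0, T]`
  have hderiv : ∀ t ∈ Icc 0 T, HasDerivWithinAt f (g t) (Icc 0 T) t := by
    intro t ht
    have hsum := HasDerivWithinAt.fun_sum (u := (Finset.univ : Finset ↥(freqBall (d := d) N)))
      (A := fun k s => ⟪h.galerkinCoeff N s k, Ψh s k⟫_ℝ)
      (A' := fun k => ⟪h.galerkinCoeff N t k, Ψh' t k⟫_ℝ + ⟪V t k, Ψh t k⟫_ℝ) (x := t) (s := Icc 0 T) fun k _ => ?_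
    · exact hsum
    · have hαk : HasDerivWithinAt (fun s => h.galerkinCoeff N s k) (V t k) (Icc 0 T) t :=
        (ContinuousLinearMap.proj (R := ℝ) (φ := fun _ : ↥(freqBall (d := d) N) => EuclideanSpace ℂ d) k).hasFDerivAt
          |>.comp_hasDerivWithinAt t (hsol T t ht)
      have hΨk : HasDerivWithinAt (fun s => Ψh s k) (Ψh' t k) (Icc 0 T) t :=
        (hasDerivAt_mFourierCoeff_slice (hΨ.isSmoothSpaceTimeOn univ) (k : d → ℤ) t).hasDerivWithinAt
      exact hαk.inner ℝ hΨk
  -- (2) `g` is continuous on `[0, T]`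
  have hgcont : ContinuousOn g (Icc 0 T) := by
    have hαc : ∀ k : ↥(freqBall (d := d) N), ContinuousOn (fun t => h.galerkinCoeff N t k) (Icc 0 T) := fun k =>
      ((continuous_apply k).comp_continuousOn hcont).mono Icc_subset_Ici_self
    have hVc : ∀ k : ↥(freqBall (d := d) N), ContinuousOn (fun t => V t k) (Icc 0 T) := fun k =>
      ((continuous_apply k).comp_continuousOn
        (continuousOn_pvsRHS_comp 𝔸 hb.continuous hb.nonneg hb.norm_le hcont)).mono Icc_subset_Ici_self
    have hΨc : ∀ k : d → ℤ, Continuous fun t => Ψh t k := fun k => hΨ.continuous_mFourierCoeff k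
    have hΨ'c : ∀ k : d → ℤ, Continuous fun t => Ψh' t k := fun k => hΨ.timeDeriv.continuous_mFourierCoeff k
    refine continuousOn_finsetSum _ fun k _ => ?_
    exact ((hαc k).inner (hΨ'c k).continuousOn).add ((hVc k).inner (hΨc k).continuousOn)
  -- (3) FTC: `∫₀ᵀ g = f T - f 0 = -f 0`
  have hfcont : ContinuousOn f (Icc 0 T) := fun t ht => (hderiv t ht).continuousWithinAt
  have hFTC := intervalIntegral.integral_eq_sub_of_hasDeriv_right_of_le hT.le hfcont
    (fun t ht => (hderiv t (Ioo_subset_Icc_self ht)).mono_of_mem_nhdsWithin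
      (mem_nhdsWithin.2 ⟨Iio T, isOpen_Iio, ht.2, fun z hz => ⟨(ht.1.trans hz.2).le, le_of_lt hz.1⟩⟩))
    (hgcont.intervalIntegrable_of_Icc hT.le)
  have hfT : f T = 0 := by
    simp only [hf, hΨh, mFourierCoeff_test_eq_zero_of_le hΨ le_rfl, inner_zero_right, Finset.sum_const_zero]
  have hf0 : f 0 = ∫ x, ⟪fourierTruncate N w₀ x, Ψ 0 x⟫_ℝ := by
    rw [← h.galerkinApprox_zero N, h.integral_inner_galerkinApprox N 0 ((hΨ.isSmooth_slice 0).memLp 2)]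
  -- (4) `g = Gt` pointwise
  have hgG : ∀ t, g t = Gt t := by
    intro t
    have hu : Integrable (h.galerkinApprox N t) volume := (memLp_realTrigPoly _ _ 2).integrable one_le_two
    have hc1 : Continuous (FunctionSpaces.Torus.timeDeriv Ψ t) := (hΨ.timeDeriv.isSmooth_slice t).continuous
    have hc2 : Continuous (FunctionSpaces.Torus.convect (b t) (fourierTruncate N (Ψ t))) :=
      ((hb.smooth t).convect (isSmooth_fourierTruncate N (Ψ t))).continuous
    have hc3 : Continuous (viscAdj (majorTranspose 𝔸) (Ψ t)) :=
      (isSmooth_viscAdj (majorTranspose 𝔸) (hΨ.isSmooth_slice t)).continuous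
    have i1 := FunctionSpaces.Torus.integrable_inner_of_continuous hu hc1
    have i2 := FunctionSpaces.Torus.integrable_inner_of_continuous hu hc2
    have i3 := FunctionSpaces.Torus.integrable_inner_of_continuous hu hc3
    have hsplit : Gt t = (∫ x, ⟪h.galerkinApprox N t x, FunctionSpaces.Torus.timeDeriv Ψ t x⟫_ℝ) +
        ((∫ x, ⟪h.galerkinApprox N t x, viscAdj (majorTranspose 𝔸) (Ψ t) x⟫_ℝ) +
          ∫ x, ⟪h.galerkinApprox N t x, FunctionSpaces.Torus.convect (b t) (fourierTruncate N (Ψ t)) x⟫_ℝ) := by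
      simp only [hGt]
      simp_rw [inner_add_right]
      have i12 : Integrable (fun x => ⟪h.galerkinApprox N t x, FunctionSpaces.Torus.timeDeriv Ψ t x⟫_ℝ +
          ⟪h.galerkinApprox N t x, FunctionSpaces.Torus.convect (b t) (fourierTruncate N (Ψ t)) x⟫_ℝ) volume := i1.add i2
      rw [integral_add i12 i3, integral_add i1 i2]
      ring
    have hrhs := h.sum_inner_rhs_eq N t (hΨ.isSmooth_slice t) (hΨdiv t)
    rw [hsplit, h.integral_inner_galerkinApprox N t ((hΨ.timeDeriv.isSmooth_slice t).memLp 2)]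
    simp only [hg, hV, hΨh, hΨh', Finset.sum_add_distrib]
    rw [hrhs]
  -- (5) assemble
  have hIoo : (∫ t in Ioo 0 T, Gt t) = ∫ t in (0:ℝ)..T, g t := by
    rw [intervalIntegral.integral_of_le hT.le, integral_Ioc_eq_integral_Ioo]
    exact setIntegral_congr_fun measurableSet_Ioo fun t _ => (hgG t).symm
  change (∫ t in Ioo 0 T, Gt t) + ∫ x, ⟪fourierTruncate N w₀ x, Ψ 0 x⟫_ℝ = 0
  rw [hIoo, hFTC, hfT, hf0]
  ring

end GalerkinWeak

end Torus

end Literature.Analysis.FluidPDE
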